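import Literature.Computability.Cryptography.LWESampling
import Literature.Computability.Cryptography.PQCLWEProofs
import HarnessLib

/-!
# The residual test of the search-to-decision reduction for LWE: acceptance probabilities

Regev (2009, §1, p. 4 of the arXiv version; §4) notes that distinguishing LWE samples from uniform
ones is "seemingly easier" than, and in fact equivalent to, solving LWE.  The easy direction
(search ⇒ decision) is the folklore *residual test*: given `T + m` samples, feed the last `m` to the
search solver to get a candidate `s'`, and accept iff many of the residuals `b_j - ⟨a_j, s'⟩` of the
first `T` samples vanish.  This file proves the two probability estimates of that test, for an
arbitrary (deterministic) candidate map `h` from `m` samples to secrets and the verdict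
`Accepts k T s' S₂ : (2k+1) T ≤ 2k · q · #{j < T | b_j - ⟨a_j, s'⟩ = 0}`:

* `toOuterMeasure_accepts_uniform_le` — on `T + m` uniform samples the test accepts with
  probability `≤ k² q² / T` (the residuals of the test block are iid uniform on `ℤ_q`, whatever `s'`
  is; Chebyshev `LWE.toOuterMeasure_iidPMF_deviation_le` with `η = 1/(2kq)`);
* `le_toOuterMeasure_accepts_lwe` — on `T + m` samples of `A_{s,χ}` with `s` uniform, if
  `χ(0) ≥ (1 + 1/k)/q` then the test accepts with probability
  `≥ (1 - k² q²/T) · Pr[h(last m samples) = s]` (given a correct candidate the residuals are iid of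
  law `χ`, `lweSample_map_residual`).

The test block comes FIRST so that the code of the solver's block is a plain suffix of the coded
sample list (this keeps the query map of the machine a projection).

The machine realising the test and the assembly of `regev_search_to_decision` are in
`LWESearchToDecision.lean`.

## References

* O. Regev, *On lattices, learning with errors, random linear codes, and cryptography*, J. ACM 56
  (2009), §1 (p. 4), §2, §4 [RegevLWE2009].
* E. Kranakis, *Primality and Cryptography*, Wiley–Teubner 1986, Thm. 3.5 [Kranakis1986].
-/

noncomputable section

open scoped ENNReal
open Finset

namespace Literature.Computability.Cryptography

namespace LWE

/-! ### The residual test -/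

section Test

variable {n q : ℕ}

/-- The number of test samples `(a_j, b_j)`, `j < T`, whose residual `b_j - ⟨a_j, s'⟩` with respect to
the candidate secret `s'` vanishes. [folklore] -/
def resCount {T : ℕ} (s' : Fin n → ZMod q) (S₂ : Fin T → (Fin n → ZMod q) × ZMod q) : ℕ :=
  (univ.filter fun j => (S₂ j).2 - (S₂ j).1 ⬝ᵥ s' = 0).card

/-- The verdict of the residual test with parameter `k` over `ℤ_q`: accept iff the fraction of
vanishing residuals is at least `(1 + 1/(2k))/q`, i.e. `(2k+1) · T ≤ 2k · q · resCount`. [folklore] -/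
def Accepts (k T : ℕ) (s' : Fin n → ZMod q) (S₂ : Fin T → (Fin n → ZMod q) × ZMod q) : Prop :=
  (2 * k + 1) * T ≤ 2 * k * q * resCount s' S₂

/-- The acceptance event of the whole test on `T + m` samples: the residuals are those of the first
`T` samples (the test block), the candidate is `h` of the last `m` (the solver's block). [folklore] -/
def acceptSet (k T m : ℕ) (h : (Fin m → (Fin n → ZMod q) × ZMod q) → Fin n → ZMod q) :
    Set (Fin (T + m) → (Fin n → ZMod q) × ZMod q) :=
  {S | Accepts k T (h fun i => S (Fin.natAdd T i)) fun j => S (Fin.castAdd m j)}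

/-- Membership in `acceptSet`. [folklore] -/
theorem mem_acceptSet {k T m : ℕ} {h : (Fin m → (Fin n → ZMod q) × ZMod q) → Fin n → ZMod q}
    {S : Fin (T + m) → (Fin n → ZMod q) × ZMod q} :
    S ∈ acceptSet k T m h ↔
      Accepts k T (h fun i => S (Fin.natAdd T i)) fun j => S (Fin.castAdd m j) :=
  Iff.rfl

/-- An appended tuple (test block, then solver's block) is accepted iff the test on its two blocks
accepts. [folklore] -/
theorem append_mem_acceptSet {k T m : ℕ} {h : (Fin m → (Fin n → ZMod q) × ZMod q) → Fin n → ZMod q}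
    (v₁ : Fin T → (Fin n → ZMod q) × ZMod q) (v₂ : Fin m → (Fin n → ZMod q) × ZMod q) :
    Fin.append v₁ v₂ ∈ acceptSet k T m h ↔ Accepts k T (h v₂) v₁ := by
  simp only [mem_acceptSet, Fin.append_left, Fin.append_right]

/-- The set of samples with vanishing residual with respect to `s'`: the graph of `a ↦ ⟨a, s'⟩`.
[folklore] -/
def zeroResidual (s' : Fin n → ZMod q) : Set ((Fin n → ZMod q) × ZMod q) :=
  Set.range fun a : Fin n → ZMod q => (a, a ⬝ᵥ s')

/-- Membership in `zeroResidual`: the residual vanishes. [folklore] -/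
theorem mem_zeroResidual_iff (s' : Fin n → ZMod q) (x : (Fin n → ZMod q) × ZMod q) :
    x ∈ zeroResidual s' ↔ x.2 - x.1 ⬝ᵥ s' = 0 := by
  constructor
  · rintro ⟨a, rfl⟩
    simp
  · intro hx
    refine ⟨x.1, ?_⟩
    rw [sub_eq_zero] at hx
    ext <;> simp [hx]

/-- `resCount` is the number of coordinates in `zeroResidual s'` (as a sum of indicators).
[folklore] -/
theorem resCount_eq_sum_indicator {T : ℕ} (s' : Fin n → ZMod q)
    (S₂ : Fin T → (Fin n → ZMod q) × ZMod q) :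
    (resCount s' S₂ : ℝ) = ∑ j, (zeroResidual s').indicator (fun _ => (1 : ℝ)) (S₂ j) := by
  classical
  unfold resCount
  rw [Finset.natCast_card_filter]
  refine Finset.sum_congr rfl fun j _ => ?_
  rw [Set.indicator_apply]
  simp only [mem_zeroResidual_iff]

variable [NeZero q]

/-- A uniform sample has vanishing residual with probability exactly `1/q`. [cite: RegevLWE2009, §4] -/
theorem toOuterMeasure_uniform_zeroResidual (s' : Fin n → ZMod q) :
    (PMF.uniformOfFintype ((Fin n → ZMod q) × ZMod q)).toOuterMeasure (zeroResidual s') =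
      (q : ℝ≥0∞)⁻¹ := by
  classical
  rw [PMF.toOuterMeasure_uniformOfFintype_apply]
  have hinj : Function.Injective fun a : Fin n → ZMod q => (a, a ⬝ᵥ s') :=
    fun a b h => (Prod.ext_iff.1 h).1
  rw [show Fintype.card (zeroResidual s') = Fintype.card (Fin n → ZMod q) by
    unfold zeroResidual; convert Set.card_range_of_injective hinj, Fintype.card_prod, Nat.cast_mul,
    ZMod.card]
  have h0 : (Fintype.card (Fin n → ZMod q) : ℝ≥0∞) ≠ 0 := by
    exact_mod_cast Fintype.card_ne_zero
  have htop : (Fintype.card (Fin n → ZMod q) : ℝ≥0∞) ≠ ∞ := ENNReal.natCast_ne_top _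
  rw [ENNReal.div_eq_inv_mul, ENNReal.mul_inv (Or.inl h0) (Or.inl htop), mul_assoc,
    mul_comm ((q : ℝ≥0∞)⁻¹), ← mul_assoc, ENNReal.inv_mul_cancel h0 htop, one_mul]

/-- The residual `b - ⟨a, s⟩` of a sample of `A_{s,χ}` has law `χ` (Regev 2009, §2).
[cite: RegevLWE2009, §2] -/
theorem lweSample_map_residual (χ : PMF (ZMod q)) (s : Fin n → ZMod q) :
    (lweSample χ s).map (fun x => x.2 - x.1 ⬝ᵥ s) = χ := by
  unfold lweSample
  rw [PMF.map_bind]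
  conv_rhs => rw [← PMF.bind_const (PMF.uniformOfFintype (Fin n → ZMod q)) χ]
  congr 1
  funext a
  rw [PMF.map_comp]
  convert PMF.map_id χ using 2
  funext e
  simp

/-- A sample of `A_{s,χ}` has vanishing residual with respect to the TRUE secret with probability
`χ(0)`. [cite: RegevLWE2009, §2] -/
theorem toOuterMeasure_lweSample_zeroResidual (χ : PMF (ZMod q)) (s : Fin n → ZMod q) :
    (lweSample χ s).toOuterMeasure (zeroResidual s) = χ 0 := by
  have hset : zeroResidual s = (fun x : (Fin n → ZMod q) × ZMod q => x.2 - x.1 ⬝ᵥ s) ⁻¹' {0} := by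
    ext x
    rw [mem_zeroResidual_iff]
    rfl
  rw [hset, ← PMF.toOuterMeasure_map_apply, lweSample_map_residual, PMF.toOuterMeasure_apply_singleton]

/-- A `PMF` gives complementary events total mass `1`. [folklore] -/
theorem toOuterMeasure_add_compl {α : Type} (p : PMF α) (A : Set α) :
    p.toOuterMeasure A + p.toOuterMeasure Aᶜ = 1 := by
  rw [PMF.toOuterMeasure_apply, PMF.toOuterMeasure_apply, ← ENNReal.tsum_add, ← p.tsum_coe]
  congr 1
  funext x
  exact Set.indicator_self_add_compl_apply A p x

/-! ### Uniform samples: the test rarely accepts -/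

omit [NeZero q] in
/-- Arithmetic of the threshold, uniform side: acceptance forces an upward deviation of the count
from `T/q` by at least `T/(2kq)`. [folklore] -/
theorem deviation_of_accepts {k T c : ℕ} (hk : 0 < k) (hq : 0 < q)
    (hacc : (2 * k + 1) * T ≤ 2 * k * q * c) :
    (T : ℝ) * (1 / (2 * k * q)) ≤ |(c : ℝ) - T * (q : ℝ)⁻¹| := by
  have hk' : (0 : ℝ) < k := by exact_mod_cast hk
  have hq' : (0 : ℝ) < q := by exact_mod_cast hq
  have h : ((2 * k + 1) * T : ℝ) ≤ 2 * k * q * c := by exact_mod_cast hacc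
  refine le_trans ?_ (le_abs_self _)
  have hc : ((2 * k + 1) * T : ℝ) / (2 * k * q) ≤ c := by
    rw [div_le_iff₀ (by positivity)]
    linarith
  have hid : (T : ℝ) * (q : ℝ)⁻¹ + T * (1 / (2 * k * q)) = (2 * k + 1) * T / (2 * k * q) := by
    field_simp
  linarith

omit [NeZero q] in
/-- Arithmetic of the threshold, LWE side: if the mean fraction is at least `(1 + 1/k)/q`, rejection
forces a downward deviation of the count from its mean by more than `T/(2kq)`. [folklore] -/
theorem deviation_of_not_accepts {k T c : ℕ} {p₀ : ℝ} (hk : 0 < k) (hq : 0 < q)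
    (hp₀ : (1 + 1 / (k : ℝ)) / q ≤ p₀) (hrej : ¬ (2 * k + 1) * T ≤ 2 * k * q * c) :
    (T : ℝ) * (1 / (2 * k * q)) ≤ |(c : ℝ) - T * p₀| := by
  have hk' : (0 : ℝ) < k := by exact_mod_cast hk
  have hq' : (0 : ℝ) < q := by exact_mod_cast hq
  have h : (2 * k * q * c : ℝ) < (2 * k + 1) * T := by exact_mod_cast Nat.lt_of_not_le hrej
  refine le_trans ?_ (neg_le_abs _)
  rw [neg_sub]
  have hp₀' : (T : ℝ) * ((1 + 1 / (k : ℝ)) / q) ≤ T * p₀ :=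
    mul_le_mul_of_nonneg_left hp₀ (Nat.cast_nonneg T)
  have hc : (c : ℝ) ≤ ((2 * k + 1) * T : ℝ) / (2 * k * q) := by
    rw [le_div_iff₀ (by positivity)]
    linarith
  have hid : (T : ℝ) * (1 / (2 * k * q)) + (2 * k + 1) * T / (2 * k * q) =
      T * ((1 + 1 / (k : ℝ)) / q) := by
    field_simp
    ring
  linarith

variable {m T : ℕ}

/-- **Uniform samples are rarely accepted.** For every candidate map `h`, on `T + m` independent
uniform samples the residual test with parameter `k ≥ 1` accepts with probability at most
`k² q² / T`: given the solver's block, the residuals of the test block are iid uniform on `ℤ_q`,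
each vanishing with probability `1/q`, and acceptance is a deviation of `T/(2kq)` (Chebyshev).
[cite: RegevLWE2009, §1 (p. 4) and §4] -/
theorem toOuterMeasure_accepts_uniform_le {k : ℕ} (hk : 0 < k) (hT : 0 < T)
    (h : (Fin m → (Fin n → ZMod q) × ZMod q) → Fin n → ZMod q) :
    (uniformSamples (Fin n) (ZMod q) (T + m)).toOuterMeasure (acceptSet k T m h) ≤
      ENNReal.ofReal ((k : ℝ) ^ 2 * (q : ℝ) ^ 2 / T) := by
  classical
  have hq : 0 < q := Nat.pos_of_ne_zero (NeZero.ne q)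
  set U := PMF.uniformOfFintype ((Fin n → ZMod q) × ZMod q) with hU
  have hunif : uniformSamples (Fin n) (ZMod q) (T + m) = iidPMF U (T + m) :=
    uniformSamples_eq_iidPMF_holds (T + m)
  -- the inner bound, for a fixed candidate `s'`
  have hinner : ∀ s' : Fin n → ZMod q,
      (iidPMF U T).toOuterMeasure {v₂ | Accepts k T s' v₂} ≤
        ENNReal.ofReal ((k : ℝ) ^ 2 * (q : ℝ) ^ 2 / T) := by
    intro s'
    have hdev := toOuterMeasure_iidPMF_deviation_le U (zeroResidual s') hT
      (η := 1 / (2 * k * q)) (by positivity)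
    rw [toOuterMeasure_uniform_zeroResidual, ENNReal.toReal_inv, ENNReal.toReal_natCast] at hdev
    have hε : (1 : ℝ) / (4 * T * (1 / (2 * k * q)) ^ 2) = (k : ℝ) ^ 2 * (q : ℝ) ^ 2 / T := by
      field_simp
      ring
    rw [hε] at hdev
    refine le_trans (PMF.toOuterMeasure_mono _ fun v₂ hv₂ => ?_) hdev
    rw [Set.mem_setOf_eq, ← resCount_eq_sum_indicator]
    exact deviation_of_accepts hk hq hv₂.1
  rw [hunif, toOuterMeasure_iidPMF_add, Finset.sum_comm]
  calc ∑ v₂ : Fin m → (Fin n → ZMod q) × ZMod q, ∑ v₁ : Fin T → (Fin n → ZMod q) × ZMod q,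
        (if Fin.append v₁ v₂ ∈ acceptSet k T m h then iidPMF U T v₁ * iidPMF U m v₂ else 0)
      = ∑ v₂ : Fin m → (Fin n → ZMod q) × ZMod q,
          iidPMF U m v₂ * (iidPMF U T).toOuterMeasure {v₁ | Accepts k T (h v₂) v₁} := by
        refine Finset.sum_congr rfl fun v₂ _ => ?_
        rw [PMF.toOuterMeasure_apply, tsum_fintype, Finset.mul_sum]
        refine Finset.sum_congr rfl fun v₁ _ => ?_
        rw [Set.indicator_apply]
        simp only [append_mem_acceptSet, Set.mem_setOf_eq]
        split_ifs <;> simp [mul_comm]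
    _ ≤ ∑ v₂ : Fin m → (Fin n → ZMod q) × ZMod q,
          iidPMF U m v₂ * ENNReal.ofReal ((k : ℝ) ^ 2 * (q : ℝ) ^ 2 / T) :=
        Finset.sum_le_sum fun v₂ _ => by gcongr; exact hinner (h v₂)
    _ = ENNReal.ofReal ((k : ℝ) ^ 2 * (q : ℝ) ^ 2 / T) := by
        rw [← Finset.sum_mul, show ∑ v₂, iidPMF U m v₂ = 1 from
          (tsum_fintype _).symm.trans (PMF.tsum_coe _), one_mul]

/-! ### LWE samples: the test accepts whenever the candidate is correct -/

/-- **LWE samples are accepted as often as the candidate is correct.** Let `χ(0) ≥ (1 + 1/k)/q`.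
On `T + m` samples of `A_{s,χ}` with `s` uniform, the residual test accepts with probability at
least `(1 - k² q²/T) · Pr[h(last m samples) = s]`: given the solver's block and a correct
candidate, the residuals of the test block are iid of law `χ`, and rejection is a deviation of more
than `T/(2kq)` below the mean (Chebyshev). [cite: RegevLWE2009, §1 (p. 4) and §4] -/
theorem le_toOuterMeasure_accepts_lwe {k : ℕ} (hk : 0 < k) (hT : 0 < T) (χ : PMF (ZMod q))
    (hχ : (1 + 1 / (k : ℝ)) / q ≤ (χ 0).toReal)
    (h : (Fin m → (Fin n → ZMod q) × ZMod q) → Fin n → ZMod q) :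
    ENNReal.ofReal (1 - (k : ℝ) ^ 2 * (q : ℝ) ^ 2 / T) *
        searchSuccessProb χ m (fun S₁ => PMF.pure (h S₁)) ≤
      (lweSamplesUniformSecret χ (T + m)).toOuterMeasure (acceptSet k T m h) := by
  classical
  have hq : 0 < q := Nat.pos_of_ne_zero (NeZero.ne q)
  set ε : ℝ := (k : ℝ) ^ 2 * (q : ℝ) ^ 2 / T with hε
  -- the inner bound, for the true secret `s`
  have hinner : ∀ s : Fin n → ZMod q,
      ENNReal.ofReal (1 - ε) ≤
        (iidPMF (lweSample χ s) T).toOuterMeasure {v₂ | Accepts k T s v₂} := by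
    intro s
    have hdev := toOuterMeasure_iidPMF_deviation_le (lweSample χ s) (zeroResidual s) hT
      (η := 1 / (2 * k * q)) (by positivity)
    rw [toOuterMeasure_lweSample_zeroResidual] at hdev
    have hε' : (1 : ℝ) / (4 * T * (1 / (2 * k * q)) ^ 2) = ε := by
      rw [hε]
      field_simp
      ring
    rw [hε'] at hdev
    have hcompl : (iidPMF (lweSample χ s) T).toOuterMeasure {v₂ | Accepts k T s v₂}ᶜ ≤
        ENNReal.ofReal ε := by
      refine le_trans (PMF.toOuterMeasure_mono _ fun v₂ hv₂ => ?_) hdev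
      rw [Set.mem_setOf_eq, ← resCount_eq_sum_indicator]
      exact deviation_of_not_accepts hk hq hχ hv₂.1
    have hadd := toOuterMeasure_add_compl (iidPMF (lweSample χ s) T) {v₂ | Accepts k T s v₂}
    have hε0 : 0 ≤ ε := by positivity
    rw [ENNReal.ofReal_sub _ hε0, ENNReal.ofReal_one]
    calc 1 - ENNReal.ofReal ε ≤ 1 - (iidPMF (lweSample χ s) T).toOuterMeasure {v₂ | Accepts k T s v₂}ᶜ :=
          tsub_le_tsub_left hcompl 1
      _ = (iidPMF (lweSample χ s) T).toOuterMeasure {v₂ | Accepts k T s v₂} := by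
          rw [← hadd, ENNReal.add_sub_cancel_right]
          exact ne_top_of_le_ne_top ENNReal.one_ne_top (by rw [← hadd]; exact le_add_self)
  -- success probability of the candidate map against `s`, as a sum over the first block
  have hsucc : ∀ s : Fin n → ZMod q,
      searchSuccessProbOf χ m (fun S₁ => PMF.pure (h S₁)) s =
        ∑ v₁ : Fin m → (Fin n → ZMod q) × ZMod q,
          if h v₁ = s then iidPMF (lweSample χ s) m v₁ else 0 := by
    intro s
    rw [searchSuccessProbOf, PMF.bind_apply, tsum_fintype]
    refine Finset.sum_congr rfl fun v₁ _ => ?_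
    rw [PMF.pure_apply]
    unfold lweSamples
    split_ifs with h1 h2 h2
    · rw [mul_one]
    · exact absurd h1.symm h2
    · exact absurd h2.symm h1
    · rw [mul_zero]
  -- assemble over the uniform secret
  rw [lweSamplesUniformSecret, PMF.toOuterMeasure_bind_apply, tsum_fintype, searchSuccessProb,
    Finset.mul_sum]
  refine Finset.sum_le_sum fun s _ => ?_
  rw [mul_left_comm]
  gcongr
  unfold lweSamples
  rw [toOuterMeasure_iidPMF_add, Finset.sum_comm, hsucc, Finset.mul_sum]
  refine Finset.sum_le_sum fun v₂ _ => ?_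
  split_ifs with hv₂
  · rw [mul_comm]
    refine le_trans (mul_le_mul_right (hinner s) (iidPMF (lweSample χ s) m v₂)) ?_
    rw [PMF.toOuterMeasure_apply, tsum_fintype, Finset.mul_sum]
    refine Finset.sum_le_sum fun v₁ _ => le_of_eq ?_
    rw [Set.indicator_apply]
    simp only [append_mem_acceptSet, Set.mem_setOf_eq, hv₂]
    split_ifs <;> simp [mul_comm]
  · simp

end Test

end LWE

end Literature.Computability.Cryptography

end
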